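import Summits.QuantumFields.GaugeBoot.DiagonalRPTorusTubeMatch
import Summits.QuantumFields.GaugeBoot.DiagonalRPTorusTubeValue
import HarnessLib

/-!
# The tube terms of the back expansion: leading order (gauge-boot, L3 sequel, 12/13)

HONEST FRAMING (cell `pub-gaugeboot`, page 1 of every file): the venture produces certified bounds
on lattice expectations at stated coupling, gauge group, dimension and torus size; NOT a mass gap,
NOT a continuum limit, NOT a string tension; NOT Yang–Mills-summit-bearing (barriers
`FixedCouplingUltralocality`, `PerturbativeInvisibility`). This module is bookkeeping for a
structural NEGATIVE result (`DiagonalRPTorusInnerHalfNegativeHighDim`); it discharges nothing by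
itself.

## Content (torus `(ℤ/L)^d`, `L = 2c`, `c ≥ 2`, `i < j < k < l`, compact metrisable `G`,
continuous `ρ` with (R1) and `c₁ > 0`)

* `tubeSet m x` — the eight ring faces `ring m x ·`, `ring m (x + e_m) ·` as a `Finset`; they are
  pairwise distinct (`card_tubeSet`, `prod_tubeSet`);
* `abs_pairT_sub_le_of_card` — for `|Q| = 8`: `|T_Q(u,v) - β⁸ ∫ Re χ(U_u) Re χ(U_v) ∏_Q Re χ(U_q)|
  ≤ N² 2⁸ (βN)⁹` (second-order Taylor remainder of `exp` per face);
* ★ **`pairT_tubeSet_ge`** — the TUBE TERM is `β⁸ c₁⁹ N` to leading order: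
  `T_{tube}(sq (x + 2e_m), sq x) ≥ β⁸ c₁⁹ N - N² 2⁸ (βN)⁹` (`tube_integral_eq`);
* the tubes of the witness lie in the rest (`tubeSet_i_subset`, `tubeSet_j_subset`) and
  `plaqSwap_sq`, `siteDiagSwap_single`, `siteDiagSwap_dn_i`: the swap on the witness squares.

Elementary bookkeeping; no named fact.
-/

open MeasureTheory Finset Function

namespace Summit.QuantumFields.GaugeBoot

open Literature.MathematicalPhysics.QuantumFieldTheory
open Literature.MathematicalPhysics.QuantumFieldTheory.PlaquetteLowerBound (reTr)
open Summit.Ventures.YMGap.RobustBall (one_ne_zero_of_three_le two_ne_zero_of_three_le)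

noncomputable section

namespace DiagRPTube

variable {d L : ℕ}

/-! ## The tube as a set of eight faces -/

section TubeSet

variable {m k l : Fin d} (hmk : m < k) (hml : m < l) (hkl : k < l)

/-- The eight ring faces between the squares at `x`, `x + e_m`, `x + 2e_m`. -/
def tubeSet (x : Site d L) : Finset (Plaquette d L) :=
  univ.image (ring hmk hml x) ∪ univ.image (ring hmk hml (x.shift m))

/-- The two rings are disjoint (`L ≥ 3`). -/
theorem disjoint_rings (hL : 3 ≤ L) (x : Site d L) :
    Disjoint (univ.image (ring (L := L) hmk hml x)) (univ.image (ring hmk hml (x.shift m))) := by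
  rw [disjoint_left]
  intro q h1 h2
  obtain ⟨a, _, rfl⟩ := mem_image.1 h1
  obtain ⟨b, _, hb⟩ := mem_image.1 h2
  have h := congrArg (fun q : Plaquette d L => q.1 m) hb
  simp only [ring, eStart_shift, WilsonRP.shift_apply_self, eStart_apply_m hmk hml] at h
  exact one_ne_zero_of_three_le hL (by linear_combination h)

include hkl in
/-- **The tube has eight faces.** -/
theorem card_tubeSet (hL : 3 ≤ L) (x : Site d L) : (tubeSet hmk hml x).card = 8 := by
  unfold tubeSet
  rw [card_union_of_disjoint (disjoint_rings hmk hml hL x),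
    card_image_of_injective _ (ring_injective hmk hml hkl hL x),
    card_image_of_injective _ (ring_injective hmk hml hkl hL (x.shift m))]
  simp

include hkl in
/-- A product over the tube is the product over the two rings. -/
theorem prod_tubeSet (hL : 3 ≤ L) (x : Site d L) (f : Plaquette d L → ℝ) :
    ∏ q ∈ tubeSet hmk hml x, f q =
      (∏ a : Fin 4, f (ring hmk hml x a)) * ∏ a : Fin 4, f (ring hmk hml (x.shift m) a) := by
  unfold tubeSet
  rw [prod_union (disjoint_rings hmk hml hL x),
    prod_image fun a _ b _ h => ring_injective hmk hml hkl hL x h,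
    prod_image fun a _ b _ h => ring_injective hmk hml hkl hL (x.shift m) h]

end TubeSet

/-! ## Leading order of a term with eight faces -/

section Leading

variable [NeZero L] {N : ℕ} {G : Type*} [Group G] [TopologicalSpace G]
  [IsTopologicalGroup G] [CompactSpace G] [MeasurableSpace G] [BorelSpace G]
  [SecondCountableTopology G] (ρ : G →* Matrix (Fin N) (Fin N) ℂ)

/-- **Leading order of a pair term with `|Q| = 8`**:
`|T_Q(u,v) - β⁸ ∫ Re χ(U_u) Re χ(U_v) ∏_{q ∈ Q} Re χ(U_q)| ≤ N² 2⁸ (βN)⁹` (`0 ≤ β`, `βN ≤ 1`). -/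
theorem abs_pairT_sub_le_of_card (hρ : Continuous ρ) {β : ℝ} (hβ : 0 ≤ β) (hβN : β * N ≤ 1)
    {Q : Finset (Plaquette d L)} (hQ : Q.card = 8) (u v : Plaquette d L) :
    |pairT ρ β Q u v - β ^ 8 * ∫ U, WilsonRP.plaqRe ρ U u * WilsonRP.plaqRe ρ U v *
        ∏ q ∈ Q, WilsonRP.plaqRe ρ U q ∂Measure.pi (fun _ : Edge d L => haarProbability G)| ≤
      N ^ 2 * (2 ^ 8 * (β * N) ^ 9) := by
  have hpow : ∀ U : GaugeConfig d L G, β ^ 8 * ∏ q ∈ Q, WilsonRP.plaqRe ρ U q =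
      ∏ q ∈ Q, β * WilsonRP.plaqRe ρ U q := fun U => by
    rw [prod_mul_distrib, prod_const, hQ]
  have hcont : Continuous fun U : GaugeConfig d L G =>
      WilsonRP.plaqRe ρ U u * WilsonRP.plaqRe ρ U v * ∏ q ∈ Q, WilsonRP.plaqRe ρ U q :=
    ((continuous_plaqRe ρ hρ u).mul (continuous_plaqRe ρ hρ v)).mul
      (continuous_finsetProd _ fun q _ => continuous_plaqRe ρ hρ q)
  have hI2 : Integrable (fun U : GaugeConfig d L G => β ^ 8 *
      (WilsonRP.plaqRe ρ U u * WilsonRP.plaqRe ρ U v * ∏ q ∈ Q, WilsonRP.plaqRe ρ U q))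
      (Measure.pi fun _ : Edge d L => haarProbability G) := (integrable_of_continuous hcont).const_mul _
  unfold pairT
  rw [← integral_const_mul, ← integral_sub (integrable_of_continuous
      (continuous_pairIntegrand ρ β hρ _ _ _)) hI2]
  have hbd : ∀ U : GaugeConfig d L G,
      ‖WilsonRP.plaqRe ρ U u * WilsonRP.plaqRe ρ U v * ∏ q ∈ Q, gfac ρ β q U -
        β ^ 8 * (WilsonRP.plaqRe ρ U u * WilsonRP.plaqRe ρ U v * ∏ q ∈ Q, WilsonRP.plaqRe ρ U q)‖ ≤
      N ^ 2 * (2 ^ 8 * (β * N) ^ 9) := fun U => by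
    have hfold : β ^ 8 * (WilsonRP.plaqRe ρ U u * WilsonRP.plaqRe ρ U v * ∏ q ∈ Q, WilsonRP.plaqRe ρ U q) =
        WilsonRP.plaqRe ρ U u * WilsonRP.plaqRe ρ U v * ∏ q ∈ Q, β * WilsonRP.plaqRe ρ U q := by
      rw [← hpow]; ring
    rw [hfold, ← mul_sub, Real.norm_eq_abs, abs_mul, abs_mul]
    have hP := WilsonRP.abs_plaqRe_le ρ hρ U u
    have hQ' := WilsonRP.abs_plaqRe_le ρ hρ U v
    have hdiff := DiagRPSUN.abs_prod_add_sub_prod_le Q (fun q => β * WilsonRP.plaqRe ρ U q)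
      (fun q => gfac ρ β q U - β * WilsonRP.plaqRe ρ U q) (t := β * N) (by positivity) hβN
      (fun q _ => by
        rw [abs_mul, abs_of_nonneg hβ]
        exact mul_le_mul_of_nonneg_left (WilsonRP.abs_plaqRe_le ρ hρ U _) hβ)
      (fun q _ => abs_gfac_sub_le ρ β hρ hβ hβN _ U)
    simp only [add_sub_cancel, hQ] at hdiff
    calc |WilsonRP.plaqRe ρ U u| * |WilsonRP.plaqRe ρ U v| *
          |∏ q ∈ Q, gfac ρ β q U - ∏ q ∈ Q, β * WilsonRP.plaqRe ρ U q|
        ≤ N * N * (2 ^ 8 * (β * N) ^ (8 + 1)) :=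
          mul_le_mul (mul_le_mul hP hQ' (abs_nonneg _) (Nat.cast_nonneg _)) hdiff
            (abs_nonneg _) (by positivity)
      _ = N ^ 2 * (2 ^ 8 * (β * N) ^ 9) := by ring
  have h := norm_integral_le_of_norm_le_const
    (μ := Measure.pi fun _ : Edge d L => haarProbability G) (ae_of_all _ hbd)
  rwa [probReal_univ, mul_one, Real.norm_eq_abs] at h

variable {m k l : Fin d} (hmk : m < k) (hml : m < l) (hkl : k < l)

include hkl in
/-- ★ **THE TUBE TERM TO LEADING ORDER**: for `0 ≤ β`, `βN ≤ 1` and (R1),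
`T_{tube}(sq (x + 2e_m), sq x) ≥ β⁸ c₁⁹ N - N² 2⁸ (βN)⁹`. -/
theorem pairT_tubeSet_ge (hL : 3 ≤ L) (hρ : Continuous ρ) {c₁ : ℝ}
    (hR1 : ∀ x y : G, ∫ g, reTr ρ (x * g⁻¹) * reTr ρ (g * y) ∂haarProbability G = c₁ * reTr ρ (x * y))
    {β : ℝ} (hβ : 0 ≤ β) (hβN : β * N ≤ 1) (x : Site d L) :
    β ^ 8 * (c₁ ^ 9 * N) - N ^ 2 * (2 ^ 8 * (β * N) ^ 9) ≤
      pairT ρ β (tubeSet hmk hml x) (sq k l hkl ((x.shift m).shift m)) (sq k l hkl x) := by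
  have hV := tube_integral_eq ρ hmk hml hkl hL hρ hR1 x
  have hsplit : ∀ U : GaugeConfig d L G,
      WilsonRP.plaqRe ρ U (sq k l hkl ((x.shift m).shift m)) * WilsonRP.plaqRe ρ U (sq k l hkl x) *
        ∏ q ∈ tubeSet hmk hml x, WilsonRP.plaqRe ρ U q =
      WilsonRP.plaqRe ρ U (sq k l hkl ((x.shift m).shift m)) * WilsonRP.plaqRe ρ U (sq k l hkl x) *
        ((∏ a : Fin 4, WilsonRP.plaqRe ρ U (ring hmk hml x a)) *
          ∏ a : Fin 4, WilsonRP.plaqRe ρ U (ring hmk hml (x.shift m) a)) := fun U => by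
    rw [prod_tubeSet hmk hml hkl hL]
  have h := abs_pairT_sub_le_of_card ρ hρ hβ hβN (card_tubeSet hmk hml hkl hL x)
    (sq k l hkl ((x.shift m).shift m)) (sq k l hkl x)
  simp_rw [hsplit] at h
  rw [hV] at h
  rw [abs_le] at h
  linarith [h.1]

end Leading

/-! ## The witness squares under the swap; the tubes lie in the rest -/

section Witness

variable {i j k l : Fin d} (hij : i < j) (hjk : j < k) (hkl : k < l)

include hij hjk hkl in
/-- `θ (sq x) = sq (θ x)` for a transverse square. -/
theorem plaqSwap_sq (x : Site d L) : plaqSwap i j (sq k l hkl x) = sq k l hkl (siteDiagSwap i j x) := by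
  have hki : k ≠ i := (ne_of_lt (hij.trans hjk)).symm
  have hkj : k ≠ j := (ne_of_lt hjk).symm
  have hli : l ≠ i := (ne_of_lt (hij.trans (hjk.trans hkl))).symm
  have hlj : l ≠ j := (ne_of_lt (hjk.trans hkl)).symm
  have hk : Equiv.swap i j k = k := Equiv.swap_apply_of_ne_of_ne hki hkj
  have hl : Equiv.swap i j l = l := Equiv.swap_apply_of_ne_of_ne hli hlj
  unfold plaqSwap sq
  refine Prod.ext rfl (Subtype.ext ?_)
  simp only [hk, hl, orderPair, dif_pos hkl]

include hij in
/-- `θ (v e_i) = v e_j`. -/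
theorem siteDiagSwap_single (v : ZMod L) : siteDiagSwap i j (Pi.single i v) = Pi.single j v := by
  have hij' : i ≠ j := ne_of_lt hij
  funext n
  simp only [siteDiagSwap]
  by_cases hni : n = i
  · subst hni
    rw [Equiv.swap_apply_left, Pi.single_eq_of_ne hij'.symm, Pi.single_eq_of_ne hij']
  · by_cases hnj : n = j
    · subst hnj
      rw [Equiv.swap_apply_right, Pi.single_eq_same, Pi.single_eq_same]
    · rw [Equiv.swap_apply_of_ne_of_ne hni hnj, Pi.single_eq_of_ne hni, Pi.single_eq_of_ne hnj]

/-- `θ (x - e_i) = θ x - e_j`. -/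
theorem siteDiagSwap_dn_i (x : Site d L) : siteDiagSwap i j (dn x i) = dn (siteDiagSwap i j x) j := by
  funext n
  simp only [siteDiagSwap, dn, Pi.sub_apply]
  by_cases hni : n = i
  · subst hni
    by_cases hij' : n = j
    · subst hij'; simp
    · rw [Equiv.swap_apply_left, Pi.single_eq_of_ne (Ne.symm hij'), Pi.single_eq_of_ne hij']
  · by_cases hnj : n = j
    · subst hnj
      rw [Equiv.swap_apply_right, Pi.single_eq_same, Pi.single_eq_same]
    · rw [Equiv.swap_apply_of_ne_of_ne hni hnj, Pi.single_eq_of_ne hni, Pi.single_eq_of_ne hnj]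

variable [NeZero L] {c : ℕ} (hc : 2 ≤ c) (hL : L = 2 * c)
include hij hjk hkl hc hL

/-- **The `i`-tube over a square on the top inner layer lies in the rest.** -/
theorem tubeSet_i_subset {x : Site d L} (hx : lay i j x = ((c - 1 : ℕ) : ZMod L)) :
    tubeSet (hij.trans hjk) (hij.trans (hjk.trans hkl)) x ⊆ restPlaqs i j c := by
  intro q hq
  unfold tubeSet at hq
  rcases mem_union.1 hq with h | h
  · obtain ⟨a, _, rfl⟩ := mem_image.1 h
    exact ring_low_i_mem hij hjk hkl hc hL hx a
  · obtain ⟨a, _, rfl⟩ := mem_image.1 h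
    have hz : lay i j ((x.shift i).shift i) = -((c - 1 : ℕ) : ZMod L) := by
      have hij' : i ≠ j := ne_of_lt hij
      rw [lay_shift_i hij', lay_shift_i hij', hx]
      have h2 : ((2 * c : ℕ) : ZMod L) = 0 := by rw [← hL]; exact ZMod.natCast_self L
      have h3 : ((c - 1 : ℕ) : ZMod L) + 1 = (c : ℕ) := cast_pred_add_one (L := L) hc
      push_cast at h2
      linear_combination h2 + 2 * h3
    have h' := ring_high_i_mem hij hjk hkl hc hL hz a
    rwa [shift_dn] at h'

/-- **The `j`-tube under a square on the top inner layer lies in the rest** (based at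
`x - 2e_j`). -/
theorem tubeSet_j_subset {x : Site d L} (hx : lay i j x = ((c - 1 : ℕ) : ZMod L)) :
    tubeSet hjk (hjk.trans hkl) (dn (dn x j) j) ⊆ restPlaqs i j c := by
  intro q hq
  unfold tubeSet at hq
  rcases mem_union.1 hq with h | h
  · obtain ⟨a, _, rfl⟩ := mem_image.1 h
    have hz : lay i j (dn (dn x j) j) = -((c - 1 : ℕ) : ZMod L) := by
      have hij' : i ≠ j := ne_of_lt hij
      rw [lay_dn_j hij', lay_dn_j hij', hx]
      have h2 : ((2 * c : ℕ) : ZMod L) = 0 := by rw [← hL]; exact ZMod.natCast_self L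
      have h3 : ((c - 1 : ℕ) : ZMod L) + 1 = (c : ℕ) := cast_pred_add_one (L := L) hc
      push_cast at h2
      linear_combination h2 + 2 * h3
    exact ring_high_j_mem hij hjk hkl hc hL hz a
  · obtain ⟨a, _, rfl⟩ := mem_image.1 h
    rw [dn_shift]
    exact ring_low_j_mem hij hjk hkl hc hL hx a

end Witness

end DiagRPTube

end

end Summit.QuantumFields.GaugeBoot
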